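import Literature.AnabelianGeometry.EtaleTheta.ThetaSubquotientOfTemperedAut

/-!
# [EtTh] §5: print's subquotient of `Aut_D(−)` is transported by ISOMORPHISMS of `B^temp(Π)⁰` compatibly with `(l·Δ_Θ)_(−)` —
# `map i ∘ autProj_E = autProj_{E′} ∘ (i⁻¹ · i)` (T56-L03 step 2, bookkeeping half)

Mochizuki, *The étale theta function and its Frobenioid-theoretic manifestations*, Publ. RIMS **45** (2009), §5 p.327 (PDF p.101) («these
subquotients determine subquotients `Aut_D(D) ↠ Aut^Θ_D(D)`; `(l·Δ_Θ)_D ⊆ Aut^Θ_D(D)`»), p.331 (PDF p.105) («the isomorphism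
`Aut_D(A_N^bs) ⥲ Aut_D(B_N^bs)` determined by the [base-equivalent!] pair») [cite: MochizukiEtTh2009, §5 p.327 (PDF p.101)].

abc-iut cell, layer L2, seat abc-iut-w5-d013 (gen 4), ROW «T56-L03 step 2».  PROOF-ONLY over abc-iut-L2-t9's
`ThetaSubquotientOfTemperedAut.lean` / `…Galois.lean` (`autPre`, `autProj`, `evalAt`, `evalAt_map`, `evalAt_autProj`); nothing edited.
* `ThetaSubquotient.conjAut_apply_point` — `(i⁻¹ σ i)(y) = i(σ(i⁻¹ y))` on points;
* `ThetaSubquotient.conjAut_mem_autPre` — conjugation along an iso `i : E ≅ E′` carries `autPre E` into `autPre E′` (same `n` at `i x`);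
* **`ThetaSubquotient.map_autProj_iso`** — for connected `E`, `E′`: `map i.hom (autProj_E σ) = autProj_{E′} (i.conjAut σ)` — t9's transport
  `lDeltaMap` along an isomorphism and the conjugation transport of `Aut_D(−)` agree on print's subquotient (used in [EtTh] §5 through
  `Aut_D(A_N^bs) ⥲ Aut_D(B_N^bs)` and, with `ThetaSubquotientOfTemperedTwistAut.twist_autProj`, for the Δ-transport of Thm. 5.6).
HONEST FRAMING: kernel-checked lemmas about abc-iut-L2-t9's carrier; nothing about the curves of [EtTh] is asserted; no side taken on
[IUTchIII] Cor. 3.12.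
-/

noncomputable section

namespace Literature.AnabelianGeometry.EtaleTheta

namespace ThetaSubquotient

open CategoryTheory Literature.AlgebraicGeometry.Frobenioids Literature.AnabelianGeometry.SemiGraphs
open Literature.AlgebraicGeometry.Frobenioids.QuasiTemperoid (stabilizerSubgroup)
open Literature.AlgebraicGeometry.Frobenioids.QuasiTemperoid.BTempConnected (hom_ρ nonempty_of_isConnectedObj)

universe u v w

variable {G : Type u} [Group G] [TopologicalSpace G] {Q : Type v} [Group Q] {Λ : Type w}
  [CommGroup Λ] (q : G →* Q) (ι : Λ →* Q)

/-- `(i.conjAut σ)(y) = i(σ(i⁻¹ y))` on points of `B^temp(Π)`. [cite: MochizukiEtTh2009, §5 p.331 (PDF p.105)] -/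
theorem conjAut_apply_point {E E' : BTemp G} (i : E ≅ E') (σ : Aut E) (y : E'.obj.V) :
    ((i.conjAut σ).hom.hom.hom y : E'.obj.V) = i.hom.hom.hom (σ.hom.hom.hom (i.inv.hom.hom y)) := by
  rw [Iso.conjAut_hom, Iso.conj_apply]
  rfl

/-- **Conjugation along an isomorphism preserves the automorphisms «given by `l·Δ_Θ`»**: if `σ ∈ Aut(E)` acts at every point through
`q⁻¹(L)`, so does `i⁻¹ σ i ∈ Aut(E′)` (at `i x` by the same `n`, by equivariance of `i`). [cite: MochizukiEtTh2009, §5 p.327 (PDF p.101)] -/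
theorem conjAut_mem_autPre {E E' : BTemp G} (i : E ≅ E') {σ : Aut E} (hσ : σ ∈ autPre q ι E) :
    i.conjAut σ ∈ autPre q ι E' := by
  intro y
  obtain ⟨n, hn, hx⟩ := hσ (i.inv.hom.hom y)
  refine ⟨n, hn, ?_⟩
  have hy : (i.hom.hom.hom (i.inv.hom.hom y) : E'.obj.V) = y :=
    congrArg (fun f : E' ⟶ E' => (f.hom.hom y : E'.obj.V)) i.inv_hom_id
  rw [conjAut_apply_point, hx, hom_ρ, hy]

variable [ι.range.Normal]

/-- **`lDeltaMap` along an isomorphism vs conjugation of `Aut`**: for connected `E`, `E′`, an isomorphism `i : E ≅ E′` and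
`σ ∈ autPre E`, `map i.hom (autProj_E σ) = autProj_{E′} (i.conjAut σ)` — both evaluate at `i x` to the class of `a` with `σ = n·(−)` at `x`,
`q n = ι a`. [cite: MochizukiEtTh2009, §5 p.327 (PDF p.101)] -/
theorem map_autProj_iso {E E' : BTemp G} (hE : IsConnectedObj E) (hE' : IsConnectedObj E') (i : E ≅ E') (σ : autPre q ι E) :
    map q ι hE hE' i.hom (autProj q ι E σ) = autProj q ι E' ⟨i.conjAut (σ : Aut E), conjAut_mem_autPre q ι i σ.2⟩ := by
  obtain ⟨x⟩ := nonempty_of_isConnectedObj E hE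
  apply evalAt_injective q ι hE' (i.hom.hom.hom x)
  obtain ⟨n, ⟨a, ha⟩, hx⟩ := σ.2 x
  have hxx : (i.inv.hom.hom (i.hom.hom.hom x) : E.obj.V) = x :=
    congrArg (fun f : E ⟶ E => (f.hom.hom x : E.obj.V)) i.hom_inv_id
  rw [evalAt_map, evalAt_autProj q ι E σ x n a ha hx, proj_mk,
    evalAt_autProj q ι E' ⟨_, conjAut_mem_autPre q ι i σ.2⟩ (i.hom.hom.hom x) n a ha (by
      change ((i.conjAut (σ : Aut E)).hom.hom.hom (i.hom.hom.hom x) : E'.obj.V) = _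
      rw [conjAut_apply_point, hxx, hx, hom_ρ])]

end ThetaSubquotient

end Literature.AnabelianGeometry.EtaleTheta

end
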